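import Summits.KontsevichZagierPeriods.KontsevichZagierPeriods.Theorems.RootDecompWalshStrataHtypeLineSquare

/-!
# Root decomposition (Walsh strata), part 57 — H-type XII: conic-edge family, constant radicand

The degenerate conic-edge residual `R-HCx°` (`E′(4E′G′ − F′²) = 0`, `Δ = E′x² + F′x + G′`,
`E′ = (m + q₂²)e − mq₁²`, `F′ = −2mq₀q₁`, `G′ = (m + q₂²)g − mq₀²`) has three sub-families: `E′ = 0 ≠ F′`
(linear radicand), `E′ = F′ = 0` (then `q₀ = 0`: CONSTANT radicand `K = (m + q₂²)g`), and the perfect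
squares `E′ > 0`.  This part closes the CONSTANT one and isolates the reusable terminal behind it:

* `InBaker.of_Hodd_chart`: `x·(ax⁴ + bx² + c)/H² · √K` on a domain inside `[0, 1]` (`e, g, K > 0`) is in
  the Baker sector — in the chart `t = H = ex² + g` of part 55 it is `(C₀ + C₁/t + C₂/t²)·√K` on a subset
  of `(g, e + g]`, the LANDED `sqrt_const` + `sqrt_const_pole` + `sqrt_const_dpole` glued by `of_sub'`;
* `InBaker.of_HCx_const`: for `E′ = 0`, `q₀ = 0` the conic-edge integrand
  `γ·Hi·q₁g·(mq₁x + sq₂√K)²/(H²√K)` is the rational summand `2smq₂γq₁²g·Hi·x/H²` (LANDED `peel_rat`, hull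
  `[0, 1]`, `g > 0`) plus `(γq₁g/K)·Hi·(m²q₁²x² + q₂²K)/H² · √K`, an `of_Hodd_chart` terminal.

References: [KontsevichZagier2001 §1.2 rules (1)–(3)], [BCR1998 §2.2].
-/

noncomputable section

open Set MeasureTheory MvPolynomial Literature.NumberTheory.Transcendental
open Literature.ModelTheory.ExponentialFields (IsSemialgebraic isSemialgebraic_univ isSemialgebraic_empty)
open Summit.KontsevichZagierPeriods.RootDecompWalshStrata.ConicDescent.VertexChart

namespace Summit.KontsevichZagierPeriods.RootDecompWalshStrata.ConicDescent.BallCube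

/-- The open half-line `{t > g}` of `ℝ¹` is `ℚ`-semialgebraic. [BCR1998 §2.2] -/
private theorem isSemialgebraic_gt_const (g : ℚ) : IsSemialgebraic ℚ {t : Fin 1 → ℝ | (g : ℝ) < t 0} := by
  convert Literature.ModelTheory.ExponentialFields.isSemialgebraic_setOf_eval_pos (k := ℚ) (R := ℝ)
    (MvPolynomial.X (0 : Fin 1) - MvPolynomial.C g : MvPolynomial (Fin 1) ℚ) using 1
  ext v
  simp only [mem_setOf_eq, map_sub, MvPolynomial.aeval_X, MvPolynomial.aeval_C, eq_ratCast, sub_pos]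

/-! #### 57.1 The odd-over-`H²` terminal -/

/-- **`x·(ax⁴ + bx² + c)/H²·√K` is in the Baker sector** (`e, g, K > 0`, domain inside `[0, 1]`): in the
chart `t = ex² + g` (`InBaker.of_Hsq_chart`) the integrand is `(C₀ + C₁/t + C₂/t²)·√K`,
`C₀ = a/(2e³)`, `C₁ = (be − 2ag)/(2e³)`, `C₂ = (ag² − beg + ce²)/(2e³)`, on a subset of `(g, e + g]`.
[KontsevichZagier2001 §1.2 rules (1)–(3); this node] -/
theorem InBaker.of_Hodd_chart (e g K a b c : ℚ) (he : 0 < e) (hg : 0 < g) (hK : 0 < K)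
    (r : KZ.IntegralRep 1) (hdom : ∀ v ∈ r.domain, 0 ≤ v 0 ∧ v 0 ≤ 1)
    (hri : EqOn r.integrand (fun t => t 0 * ((a : ℝ) * t 0 ^ 4 + b * t 0 ^ 2 + c) /
      ((e : ℝ) * t 0 ^ 2 + g) ^ 2 * √(qD 0 0 K (t 0))) r.domain) :
    InBaker (KZ.of r) := by
  have he0 : (0 : ℝ) < e := by exact_mod_cast he
  have hg0 : (0 : ℝ) < g := by exact_mod_cast hg
  have hK0 : (0 : ℝ) < K := by exact_mod_cast hK
  have hH : ∀ x : ℝ, 0 < (e : ℝ) * x ^ 2 + g := fun x => by positivity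
  have hqD : ∀ y : ℝ, qD 0 0 K y = K := fun y => by simp [qD]
  obtain ⟨C0, hC0⟩ : ∃ q : ℚ, q = a / (2 * e ^ 3) := ⟨_, rfl⟩
  obtain ⟨C1, hC1⟩ : ∃ q : ℚ, q = (b * e - 2 * a * g) / (2 * e ^ 3) := ⟨_, rfl⟩
  obtain ⟨C2, hC2⟩ : ∃ q : ℚ, q = (a * g ^ 2 - b * e * g + c * e ^ 2) / (2 * e ^ 3) := ⟨_, rfl⟩
  refine InBaker.of_split_at 0 r (fun r₂ hd₂ hi₂ => ?_) fun r₂ hd₂ hi₂ => ?_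
  swap
  · -- `x < 0`: empty
    refine InBaker.of_domain_eq_empty r₂ ?_
    rw [hd₂]
    refine Set.eq_empty_of_subset_empty fun v hv => ?_
    exfalso
    obtain ⟨h00, -⟩ := hdom v hv.1
    have h2 : v 0 < ((0 : ℚ) : ℝ) := hv.2
    rw [Rat.cast_zero] at h2
    linarith
  have hdom₂ : ∀ v ∈ r₂.domain, 0 < v 0 ∧ v 0 ≤ 1 := fun v hv => by
    rw [hd₂] at hv
    obtain ⟨hv1, hv0⟩ := hv
    have hv0' : ((0 : ℚ) : ℝ) < v 0 := hv0
    rw [Rat.cast_zero] at hv0'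
    exact ⟨hv0', (hdom v hv1).2⟩
  have hT := isSemialgebraic_gt_const g
  have hne : ∀ t ∈ {t : Fin 1 → ℝ | (g : ℝ) < t 0}, t 0 - ((0 : ℚ) : ℝ) ≠ 0 := fun t ht => by
    have h2 : (g : ℝ) < t 0 := ht
    rw [Rat.cast_zero, sub_zero]
    exact (hg0.trans h2).ne'
  refine InBaker.of_Hsq_chart e g he r₂ (fun v hv => (hdom₂ v hv).1)
    (fun t => (C0 : ℝ) * √(qD 0 0 K (t 0)) + (C1 : ℝ) / (t 0 - ((0 : ℚ) : ℝ)) * √(qD 0 0 K (t 0)) +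
      (C2 : ℝ) / (t 0 - ((0 : ℚ) : ℝ)) ^ 2 * √(qD 0 0 K (t 0))) ?_ (fun v hv => ?_)
    fun r₃ hd₃ hi₃ => ?_
  · -- semialgebraic on `{t > g}`
    have hKc := isSemialgebraicFunOn_ratCast hT C0
    have hA : IsRatOn {t : Fin 1 → ℝ | (g : ℝ) < t 0} fun t => (C1 : ℝ) / (t 0 - ((0 : ℚ) : ℝ)) :=
      (IsRatOn.const C1).div (IsRatOn.coord.sub (IsRatOn.const 0)) hne
    have hB : IsRatOn {t : Fin 1 → ℝ | (g : ℝ) < t 0} fun t => (C2 : ℝ) / (t 0 - ((0 : ℚ) : ℝ)) ^ 2 :=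
      (IsRatOn.const C2).div ((IsRatOn.coord.sub (IsRatOn.const 0)).pow 2) fun t ht =>
        pow_ne_zero 2 (hne t ht)
    have hsqr := IsSemialgebraicFunOn.sqrt_holds (isSemialgebraicFunOn_qD 0 0 K hT)
    exact (((hKc.mul_holds hsqr).add_holds ((hA.isSemialgebraicFunOn hT).mul_holds hsqr)).add_holds
      ((hB.isSemialgebraicFunOn hT).mul_holds hsqr)).congr fun t _ => by
        simp only [Pi.add_apply, Pi.mul_apply]
  · -- the integrand in the chart
    have hv1 : v ∈ r.domain := by rw [hd₂] at hv; exact hv.1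
    have hHne := (hH (v 0)).ne'
    have hene : (e : ℝ) ≠ 0 := he0.ne'
    rw [hi₂, hri hv1]
    dsimp only
    rw [hqD, hqD, Rat.cast_zero, sub_zero, hC0, hC1, hC2]
    push_cast
    field_simp
    ring
  · -- the pulled-back integrand: three scaled poles on a subset of `(g, e + g]`
    have hdg : ∀ t ∈ r₃.domain, (g : ℝ) < t 0 := fun t ht => by
      rw [hd₃] at ht; exact ht.1
    have hdle : ∀ t ∈ r₃.domain, t 0 ≤ (e : ℝ) + g := fun t ht => by
      rw [hd₃] at ht
      obtain ⟨ht1, ht2⟩ := ht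
      have ht1' : (g : ℝ) < t 0 := ht1
      obtain ⟨-, h1⟩ := hdom₂ _ ht2
      simp only [lift₁_apply] at h1
      have hp : 0 ≤ (t 0 - g) / e := (div_pos (sub_pos.2 ht1') he0).le
      have h2 : (t 0 - g) / e ≤ 1 := by
        nlinarith [Real.sqrt_nonneg ((t 0 - g) / e), Real.sq_sqrt hp]
      have h3 := (div_le_one he0).1 h2
      linarith
    have hb : Bornology.IsBounded r₃.domain := by
      refine isBounded_iff_forall_norm_le.2 ⟨(e : ℝ) + g, fun t ht => ?_⟩
      refine (pi_norm_le_iff_of_nonneg (by positivity)).2 fun i => ?_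
      rw [Fin.eq_zero i, Real.norm_eq_abs, abs_le]
      exact ⟨by linarith [hdg t ht], hdle t ht⟩
    have hne₃ : ∀ t ∈ r₃.domain, t 0 - ((0 : ℚ) : ℝ) ≠ 0 := fun t ht => hne t (hdg t ht)
    have hfK : IsSemialgebraicFunOn ℚ r₃.domain fun t => (C0 : ℝ) * √(qD 0 0 K (t 0)) :=
      ((isSemialgebraicFunOn_ratCast r₃.isSemialgebraic_domain C0).mul_holds
        (IsSemialgebraicFunOn.sqrt_holds (isSemialgebraicFunOn_qD 0 0 K r₃.isSemialgebraic_domain))).congr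
        fun t _ => by simp only [Pi.mul_apply]
    have hMK : ∀ t ∈ r₃.domain, |(C0 : ℝ) * √(qD 0 0 K (t 0))| ≤ |(C0 : ℝ)| * √(K : ℝ) := by
      intro t _
      rw [hqD, abs_mul, abs_of_nonneg (Real.sqrt_nonneg _)]
    refine InBaker.of_sub' r₃ (bddRep r₃.domain r₃.isSemialgebraic_domain hb _ hfK _ hMK) rfl
      (InBaker.sqrt_const K C0 hK _ fun t _ => rfl) ?_
    have hfA : IsSemialgebraicFunOn ℚ r₃.domain
        fun t => (C1 : ℝ) / (t 0 - ((0 : ℚ) : ℝ)) * √(qD 0 0 K (t 0)) :=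
      ((((IsRatOn.const C1).div (IsRatOn.coord.sub (IsRatOn.const 0)) hne₃).isSemialgebraicFunOn
        r₃.isSemialgebraic_domain).mul_holds (IsSemialgebraicFunOn.sqrt_holds
          (isSemialgebraicFunOn_qD 0 0 K r₃.isSemialgebraic_domain))).congr fun t _ => by
        simp only [Pi.mul_apply]
    have hMA : ∀ t ∈ r₃.domain,
        |(C1 : ℝ) / (t 0 - ((0 : ℚ) : ℝ)) * √(qD 0 0 K (t 0))| ≤ |(C1 : ℝ)| / g * √(K : ℝ) := by
      intro t ht
      have htg := hdg t ht
      have ht0 : 0 < t 0 := hg0.trans htg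
      rw [hqD, Rat.cast_zero, sub_zero, abs_mul, abs_div, abs_of_pos ht0,
        abs_of_nonneg (Real.sqrt_nonneg _)]
      exact mul_le_mul_of_nonneg_right (div_le_div_of_nonneg_left (abs_nonneg _) hg0 htg.le)
        (Real.sqrt_nonneg _)
    refine InBaker.of_sub' _ (bddRep r₃.domain r₃.isSemialgebraic_domain hb _ hfA _ hMA) rfl
      (InBaker.sqrt_const_pole K 0 C1 hK _ fun t _ => rfl) ?_
    refine InBaker.sqrt_const_dpole K 0 C2 hK _ fun t _ => ?_
    show (r₃.integrand t - (C0 : ℝ) * √(qD 0 0 K (t 0))) -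
      (C1 : ℝ) / (t 0 - ((0 : ℚ) : ℝ)) * √(qD 0 0 K (t 0)) = _
    rw [hi₃]
    ring

/-! #### 57.2 The conic-edge family with constant radicand (`E′ = 0`, `q₀ = 0`) -/

/-- Rational summand numerator `2smq₂γq₁²g · Hi · X` of the constant-radicand conic case. [this node] -/
def hCcNA (e g m γ q1 q2 s : ℚ) : Polynomial ℚ :=
  Polynomial.C (2 * s * m * q2 * γ * q1 ^ 2 * g) * hPi e g * Polynomial.X

/-- `hCcNA(x) = 2smq₂γq₁²g · Hi(x) · x`. [bookkeeping] -/
theorem aeval_hCcNA (e g m γ q1 q2 s : ℚ) (x : ℝ) :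
    Polynomial.aeval x (hCcNA e g m γ q1 q2 s) =
      2 * (s : ℝ) * m * q2 * γ * q1 ^ 2 * g * ((e : ℝ) / 3 * x ^ 3 + g * x) * x := by
  simp only [hCcNA, map_mul, Polynomial.aeval_C, Polynomial.aeval_X, eq_ratCast, aeval_hPi]
  push_cast
  ring

/-- **Conic-edge family, CONSTANT radicand** (`E′ = (m + q₂²)e − mq₁² = 0` and `q₀ = 0`, so
`Δ ≡ K = (m + q₂²)g`; a non-empty domain forces `g > 0`): `peel_rat` + `of_Hodd_chart`.
[KontsevichZagier2001 §1.2 rules (1)–(3); this node] -/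
theorem InBaker.of_HCx_const (e g m γ q0 q1 q2 s : ℚ) (he : 0 < e) (hm : 1 ≤ m) (hs : s = 1 ∨ s = -1)
    (hE0 : (m + q2 ^ 2) * e - m * q1 ^ 2 = 0) (hq0 : q0 = 0)
    (S : Set (Fin 1 → ℝ)) (hS : IsSemialgebraic ℚ S)
    (hdom : ∀ t ∈ S, (0 ≤ t 0 ∧ t 0 ≤ 1) ∧ 0 < (e : ℝ) * t 0 ^ 2 + g ∧
      0 < ((m : ℝ) + q2 ^ 2) * ((e : ℝ) * t 0 ^ 2 + g) - m * ((q0 : ℝ) + q1 * t 0) ^ 2)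
    (r : KZ.IntegralRep 1) (hrd : r.domain = S)
    (hri : EqOn r.integrand (fun t => (γ : ℝ) * ((e : ℝ) / 3 * t 0 ^ 3 + g * t 0) * ((q1 : ℝ) * g - e * q0 * t 0) *
      ((m : ℝ) * ((q0 : ℝ) + q1 * t 0) +
        s * q2 * √(((m : ℝ) + q2 ^ 2) * ((e : ℝ) * t 0 ^ 2 + g) - m * ((q0 : ℝ) + q1 * t 0) ^ 2)) ^ 2 /
      (((e : ℝ) * t 0 ^ 2 + g) ^ 2 *
        √(((m : ℝ) + q2 ^ 2) * ((e : ℝ) * t 0 ^ 2 + g) - m * ((q0 : ℝ) + q1 * t 0) ^ 2))) S) :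
    InBaker (KZ.of r) := by
  have _hS := hS
  subst hrd
  subst hq0
  have he0 : (0 : ℝ) < e := by exact_mod_cast he
  have hm0Q : 0 < m := zero_lt_one.trans_le hm
  have hs2 : (s : ℝ) ^ 2 = 1 := by rcases hs with h | h <;> simp [h]
  obtain ⟨K, hK⟩ : ∃ K : ℚ, K = (m + q2 ^ 2) * g := ⟨_, rfl⟩
  have hE0R : ((m : ℝ) + q2 ^ 2) * e - m * q1 ^ 2 = 0 := by exact_mod_cast hE0
  have hradR : ∀ x : ℝ,
      ((m : ℝ) + q2 ^ 2) * ((e : ℝ) * x ^ 2 + g) - m * (((0 : ℚ) : ℝ) + q1 * x) ^ 2 = (K : ℝ) := by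
    intro x
    rw [hK]
    push_cast
    linear_combination (x ^ 2) * hE0R
  rcases lt_or_ge 0 g with hg | hg
  swap
  · -- `g ≤ 0`: then `K ≤ 0` and the domain is empty
    refine InBaker.of_domain_eq_empty r (Set.eq_empty_of_subset_empty fun v hv => ?_)
    exfalso
    obtain ⟨-, -, h3⟩ := hdom v hv
    rw [hradR] at h3
    have hK0 : K ≤ 0 := by
      rw [hK]; exact mul_nonpos_iff.2 (Or.inl ⟨by positivity, hg⟩)
    have hK0R : (K : ℝ) ≤ 0 := by exact_mod_cast hK0
    linarith
  have hg0 : (0 : ℝ) < g := by exact_mod_cast hg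
  have hKpos : 0 < K := by rw [hK]; positivity
  have hK0 : (0 : ℝ) < K := by exact_mod_cast hKpos
  obtain ⟨w, hw⟩ : ∃ w : ℝ, w = √(K : ℝ) := ⟨_, rfl⟩
  have hw0 : 0 < w := by rw [hw]; exact Real.sqrt_pos.2 hK0
  have hw2 : w ^ 2 = K := by rw [hw]; exact Real.sq_sqrt hK0.le
  have hw' : w = (K : ℝ) / w := by
    rw [eq_div_iff hw0.ne', ← hw2]
    ring
  have hqD : ∀ y : ℝ, qD 0 0 K y = K := fun y => by simp [qD]
  have hI01 : ∀ v ∈ r.domain, ((0 : ℚ) : ℝ) ≤ v 0 ∧ v 0 ≤ ((1 : ℚ) : ℝ) := fun v hv => by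
    obtain ⟨⟨h0, h1⟩, -⟩ := hdom v hv
    exact ⟨by exact_mod_cast h0, by exact_mod_cast h1⟩
  have hQh : ∀ x : ℝ, ((0 : ℚ) : ℝ) ≤ x → x ≤ ((1 : ℚ) : ℝ) → Polynomial.aeval x (hP e g ^ 2) ≠ 0 := by
    intro x hx _
    have hx0 : (0 : ℝ) ≤ x := by exact_mod_cast hx
    rw [map_pow, aeval_hP]
    exact pow_ne_zero 2 (add_pos_of_nonneg_of_pos (mul_nonneg he0.le (sq_nonneg x)) hg0).ne'
  obtain ⟨c0, hc0⟩ : ∃ q : ℚ, q = γ * q1 * g / K := ⟨_, rfl⟩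
  obtain ⟨a, ha⟩ : ∃ q : ℚ, q = c0 * (e / 3 * (m ^ 2 * q1 ^ 2)) := ⟨_, rfl⟩
  obtain ⟨b, hb⟩ : ∃ q : ℚ, q = c0 * (e / 3 * (q2 ^ 2 * K) + g * (m ^ 2 * q1 ^ 2)) := ⟨_, rfl⟩
  obtain ⟨cc, hcc⟩ : ∃ q : ℚ, q = c0 * (g * (q2 ^ 2 * K)) := ⟨_, rfl⟩
  refine InBaker.peel_rat (hCcNA e g m γ q1 q2 s) (hP e g ^ 2) 0 1 hQh r hI01
    (fun v => v 0 * ((a : ℝ) * v 0 ^ 4 + b * v 0 ^ 2 + cc) / ((e : ℝ) * v 0 ^ 2 + g) ^ 2 *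
      √(qD 0 0 K (v 0)))
    (fun v hv => ?_) fun rB hBd hBi =>
      InBaker.of_Hodd_chart e g K a b cc he hg hKpos rB
        (fun v hv => (hdom v (by rw [hBd] at hv; exact hv)).1) hBi
  -- the integrand identity
  obtain ⟨-, hH, -⟩ := hdom v hv
  have hHne := hH.ne'
  have hKne : (K : ℝ) ≠ 0 := hK0.ne'
  have hwne := hw0.ne'
  have hsq : ((m : ℝ) * (((0 : ℚ) : ℝ) + q1 * v 0) + s * q2 * w) ^ 2 =
      (m : ℝ) ^ 2 * q1 ^ 2 * v 0 ^ 2 + 2 * m * q1 * q2 * s * v 0 * w + q2 ^ 2 * K := by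
    rw [Rat.cast_zero, zero_add]
    linear_combination ((q2 : ℝ) ^ 2 * (s : ℝ) ^ 2) * hw2 + ((q2 : ℝ) ^ 2 * (K : ℝ)) * hs2
  rw [hri hv]
  dsimp only
  rw [hradR, ← hw, hsq, aeval_hCcNA, map_pow, aeval_hP, hqD, ← hw]
  conv_rhs => rw [hw']
  rw [ha, hb, hcc, hc0, Rat.cast_zero]
  push_cast
  field_simp
  ring

end Summit.KontsevichZagierPeriods.RootDecompWalshStrata.ConicDescent.BallCube
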